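import Literature.GroupTheory.CombinatorialGroupTheory.NielsenCancellation
import Literature.GroupTheory.CombinatorialGroupTheory.QuadraticWords
import HarnessLib

/-!
# Nielsen's length argument for a single product, and free reduction with provenance

Topic `Literature/GroupTheory/CombinatorialGroupTheory`.  Two word-combinatorial lemmas for
Zieschang's method of alternating products (ZVC §5.2, proof of Thm. 5.2.8: *"In it, at least one
letter remains of each factor"*):

* `LocallyReduced L` — a sequence `L = (u₁, …, u_m)` of elements of a free group has **the
  Nielsen property** (ZVC 5.2.6–5.2.7; Lyndon–Schupp I §2 (N0)–(N2), but only for CONSECUTIVE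
  factors of the one product `u₁ ⋯ u_m`): no factor is trivial, at most half of each of two
  consecutive factors cancels between them, and no factor has exactly one half cancelled by
  each of its two neighbours.  Then every factor keeps a letter in the product
  (`LocallyReduced.exists_toWord_prod_eq`, the invariant of Lyndon–Schupp's proof of Prop. 2.3
  localised), so `m ≤ ‖u₁ ⋯ u_m‖` (`length_le_norm`) and in particular **a nonempty product with
  the Nielsen property is not trivial** (`prod_ne_one`).  (The tree's `IsNielsenReduced`,
  `NielsenReduced.lean`, asks (N1)–(N2) of ALL pairs and triples of a system; here only the
  neighbours in one product are constrained, which is what a cancellation argument along a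
  fixed quadratic word provides.)
* `exists_reduce_filter_decomp` — **free reduction with provenance**: deleting the letters
  failing a predicate `q` from a word `w` and freely reducing, the surviving letters sit in `w`
  as `w = pre ++ [x₁] ++ g₁ ++ [x₂] ++ g₂ ++ ⋯ ++ [x_m] ++ g_m` with `reduce (w.filter q) =
  [x₁, …, x_m]` and every gap `gⱼ` (and `pre`) trivial after deleting the non-`q` letters.

## References

* H. Zieschang, E. Vogt, H.-D. Coldewey, *Surfaces and Planar Discontinuous Groups*, LNM 835
  (1980), 5.2.6–5.2.8. [ZieschangVogtColdewey1980]
* R. C. Lyndon, P. E. Schupp, *Combinatorial Group Theory* (2001), Ch. I §2, Prop. 2.3, Cor. 2.4.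
  [LyndonSchupp2001]
-/

namespace Literature.GroupTheory.CombinatorialGroupTheory

open List

/-! ### The Nielsen property of one product -/

section Collapse

variable {α : Type*} [DecidableEq α]

/-- The cancellation of the first factor of a sequence against the second (`0` for fewer than
two factors). [folklore] -/
def headCancelL : List (FreeGroup α) → ℕ
  | x :: y :: _ => maxCancel x.toWord y.toWord
  | _ => 0

/-- **The Nielsen property of a product `u₁ ⋯ u_m`** (ZVC 5.2.6 (a),(b), 5.2.7; Lyndon–Schupp
(N0)–(N2) for consecutive factors): no factor is `1`; for consecutive factors `x, y` at most half
of each cancels in `xy`; for consecutive `x, y, z` it is not the case that exactly half of `y`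
cancels into `x` and exactly half into `z`. [cite: ZieschangVogtColdewey1980, 5.2.6–5.2.7] -/
structure LocallyReduced (L : List (FreeGroup α)) : Prop where
  /-- (N0): no factor is trivial. -/
  ne_one : ∀ x ∈ L, x ≠ 1
  /-- (N1) for consecutive factors. -/
  pair : ∀ (P Q : List (FreeGroup α)) (x y : FreeGroup α), L = P ++ x :: y :: Q →
    2 * maxCancel x.toWord y.toWord ≤ x.norm ∧ 2 * maxCancel x.toWord y.toWord ≤ y.norm
  /-- (N2) for consecutive factors. -/
  triple : ∀ (P Q : List (FreeGroup α)) (x y z : FreeGroup α), L = P ++ x :: y :: z :: Q →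
    ¬ (2 * maxCancel x.toWord y.toWord = y.norm ∧ 2 * maxCancel y.toWord z.toWord = y.norm)

namespace LocallyReduced

/-- The Nielsen property passes to the tail. [folklore] -/
theorem tail {x : FreeGroup α} {L : List (FreeGroup α)} (h : LocallyReduced (x :: L)) :
    LocallyReduced L where
  ne_one y hy := h.ne_one y (mem_cons_of_mem x hy)
  pair P Q a b hL := h.pair (x :: P) Q a b (by rw [hL]; rfl)
  triple P Q a b c hL := h.triple (x :: P) Q a b c (by rw [hL]; rfl)

/-- **The invariant of Nielsen's length argument, local form**: for a sequence `x :: L` with the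
Nielsen property, the reduced word of the product begins with the first `‖x‖ - k` letters of
`x` (`k` the cancellation of `x` against the next factor), followed by at least `|L|` further
letters. [cite: LyndonSchupp2001, Ch. I Prop. 2.3] -/
theorem exists_toWord_prod_eq :
    ∀ (x : FreeGroup α) (L : List (FreeGroup α)), LocallyReduced (x :: L) →
      ∃ A : List (α × Bool),
        (x :: L).prod.toWord = x.toWord.take (x.norm - headCancelL (x :: L)) ++ A ∧
        L.length ≤ A.length
  | x, [], _ => ⟨[], by simp [headCancelL, FreeGroup.norm], by simp⟩
  | x, y :: L, h => by
    have hyL : LocallyReduced (y :: L) := h.tail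
    obtain ⟨A', hA', hlen'⟩ := exists_toWord_prod_eq y L hyL
    set X := x.toWord with hX
    set Y := y.toWord with hY
    set c := maxCancel X Y with hc
    set d := headCancelL (y :: L) with hd
    set T' := Y.take (Y.length - d) with hT'
    have hYn : Y.length = y.norm := rfl
    have hXn : X.length = x.norm := rfl
    -- (N1) for `x, y`
    obtain ⟨hc₁, hc₂⟩ := h.pair [] L x y rfl
    rw [← hX, ← hY, ← hc, ← hXn] at hc₁
    rw [← hX, ← hY, ← hc, ← hYn] at hc₂
    -- `d ≤ |Y| / 2`, and `c < |T'|`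
    have hd2 : 2 * d ≤ Y.length := by
      cases L with
      | nil => simp [hd, headCancelL]
      | cons z L => exact (hyL.pair [] L y z rfl).1
    have hT'len : T'.length = Y.length - d := by
      rw [hT', length_take]; omega
    have hcT : c < T'.length := by
      rw [hT'len]
      by_contra hge
      have hge := not_lt.1 hge
      -- then `2c = |Y| = 2d`, contradicting (N2) (or (N0) if `L = []`)
      have hcY : 2 * c = Y.length := by omega
      cases L with
      | nil =>
        have hd0 : d = 0 := by simp [hd, headCancelL]
        have hY0 : Y.length = 0 := by omega
        have : y = 1 := by
          rw [← FreeGroup.toWord_eq_nil_iff, ← hY]; exact length_eq_zero_iff.1 hY0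
        exact h.ne_one y (by simp) this
      | cons z L =>
        have hdY : 2 * d = Y.length := by omega
        exact h.triple [] L x y z rfl ⟨by rw [← hYn]; exact hcY, by rw [← hYn]; exact hdY⟩
    -- the cancellation of `X` against the whole product equals `c`
    have hprod : (y :: L).prod.toWord = T' ++ A' := hA'
    have hc' : maxCancel X (T' ++ A') = c := by
      rw [hc]
      show cancelAux X.reverse (T' ++ A') = cancelAux X.reverse Y
      apply cancelAux_eq_of_take_eq X.reverse Y (T' ++ A') T'.length
      · rw [take_append_of_le_length le_rfl, take_length, hT'len]
      · exact hcT
      · rw [hT'len]; omega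
    -- compute the word of the full product
    refine ⟨T'.drop c ++ A', ?_, ?_⟩
    · rw [prod_cons, toWord_mul_eq, hprod, hc', ← hX, drop_append_of_le_length hcT.le]
      rfl
    · rw [length_append, length_drop, length_cons]
      omega

/-- **The length inequality, local form** (ZVC, proof of 5.2.8: *"at least one letter remains
of each factor"*; Lyndon–Schupp I Cor. 2.4 for one product): a product with the Nielsen
property has length at least the number of its factors. [cite: ZieschangVogtColdewey1980, 5.2.8 (proof)] -/
theorem length_le_norm {L : List (FreeGroup α)} (h : LocallyReduced L) : L.length ≤ L.prod.norm := by
  cases L with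
  | nil => simp
  | cons x L =>
    obtain ⟨A, hA, hlen⟩ := h.exists_toWord_prod_eq x L
    have hX1 : 1 ≤ x.norm := by
      rw [Nat.one_le_iff_ne_zero, Ne, FreeGroup.norm_eq_zero]
      exact h.ne_one x (by simp)
    have hc : 2 * headCancelL (x :: L) ≤ x.norm := by
      cases L with
      | nil => simp [headCancelL]
      | cons y L => exact (h.pair [] L x y rfl).1
    have := congrArg List.length hA
    rw [length_append, length_take] at this
    simp only [FreeGroup.norm] at *
    rw [length_cons, this]
    omega

/-- **A nonempty product with the Nielsen property is not trivial.** [cite: ZieschangVogtColdewey1980, 5.2.8 (proof)] -/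
theorem prod_ne_one {L : List (FreeGroup α)} (h : LocallyReduced L) (hL : L ≠ []) : L.prod ≠ 1 := by
  intro h1
  have := h.length_le_norm
  rw [h1, FreeGroup.norm_one, Nat.le_zero, length_eq_zero_iff] at this
  exact hL this

end LocallyReduced

/-- **Collapse**: if a nonempty product of nontrivial elements of a free group is trivial, then
the Nielsen property fails at consecutive factors: either more than half of one of two
consecutive factors cancels between them, or some factor has exactly its two halves cancelled
by its two neighbours. [cite: ZieschangVogtColdewey1980, 5.2.6–5.2.8] -/
theorem exists_violation_of_prod_eq_one {L : List (FreeGroup α)} (hne : ∀ x ∈ L, x ≠ 1)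
    (hL : L ≠ []) (h1 : L.prod = 1) :
    (∃ (P Q : List (FreeGroup α)) (x y : FreeGroup α), L = P ++ x :: y :: Q ∧
      (x.norm < 2 * maxCancel x.toWord y.toWord ∨ y.norm < 2 * maxCancel x.toWord y.toWord)) ∨
    (∃ (P Q : List (FreeGroup α)) (x y z : FreeGroup α), L = P ++ x :: y :: z :: Q ∧
      2 * maxCancel x.toWord y.toWord = y.norm ∧ 2 * maxCancel y.toWord z.toWord = y.norm) := by
  by_contra hcon
  rw [not_or, not_exists, not_exists] at hcon
  obtain ⟨hp, ht⟩ := hcon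
  refine LocallyReduced.prod_ne_one ⟨hne, fun P Q x y hPQ => ?_, fun P Q x y z hPQ hh => ?_⟩ hL h1
  · have := hp P
    simp only [not_exists, not_and, not_or, not_lt] at this
    exact this Q x y hPQ
  · have := ht P
    simp only [not_exists, not_and] at this
    exact this Q x y z hPQ hh.1 hh.2

end Collapse

/-! ### Free reduction with provenance -/

section Decomp

variable {ι : Type*} [DecidableEq ι]

/-- Letters of the reduced word are letters of the word. [folklore] -/
theorem mem_of_mem_reduce {L : List (ι × Bool)} {x : ι × Bool} (hx : x ∈ FreeGroup.reduce L) : x ∈ L :=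
  (FreeGroup.reduce.red (L := L)).sublist.subset hx

omit [DecidableEq ι] in
/-- A cancelling pair of letters is trivial: `mk (x :: y :: M) = mk M` if `x` is the formal
inverse of `y`. [folklore] -/
theorem mk_cons_cons_of_cancel {x y : ι × Bool} (h : x.1 = y.1 ∧ x.2 = !y.2) (M : List (ι × Bool)) :
    FreeGroup.mk (x :: y :: M) = FreeGroup.mk M := by
  obtain ⟨i, s⟩ := x
  obtain ⟨j, t⟩ := y
  simp only at h
  obtain ⟨rfl, rfl⟩ := h
  rw [mk_cons_eq_sgen_mul, mk_cons_eq_sgen_mul, sgen_not, inv_mul_cancel_left]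

/-- **Free reduction with provenance.**  For a predicate `q` on letters and a word `w`, the
letters of `reduce (w.filter q)` sit in `w` in order, `w = pre ++ [x₁] ++ g₁ ++ ⋯ ++ [x_m] ++ g_m`,
with `pre` and every gap `gⱼ` trivial in the free group after deleting their non-`q` letters.
[folklore] -/
theorem exists_reduce_filter_decomp (q : ι × Bool → Bool) : ∀ (w : List (ι × Bool)),
    ∃ (pre : List (ι × Bool)) (blocks : List ((ι × Bool) × List (ι × Bool))),
      w = pre ++ (blocks.map fun b => b.1 :: b.2).flatten ∧
      FreeGroup.reduce (w.filter q) = blocks.map Prod.fst ∧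
      FreeGroup.mk (pre.filter q) = 1 ∧ ∀ b ∈ blocks, FreeGroup.mk (b.2.filter q) = 1
  | [] => ⟨[], [], by simp, by simp, by simp [show (FreeGroup.mk [] : FreeGroup ι) = 1 from rfl], by simp⟩
  | x :: w => by
    obtain ⟨pre, blocks, hw, hred, hpre, hgap⟩ := exists_reduce_filter_decomp q w
    by_cases hqx : q x = true
    · rw [filter_cons_of_pos hqx, FreeGroup.reduce.cons, hred]
      cases blocks with
      | nil =>
        refine ⟨[], [(x, pre)], ?_, by simp, by simp [show (FreeGroup.mk [] : FreeGroup ι) = 1 from rfl], ?_⟩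
        · simp [hw]
        · simpa using hpre
      | cons b rest =>
        obtain ⟨y, g⟩ := b
        simp only [map_cons]
        by_cases hc : x.1 = y.1 ∧ x.2 = !y.2
        · -- `x` cancels the first survivor `y`: the new `pre` swallows `x … y g`
          rw [if_pos hc]
          have hqy : q y = true := by
            have hy : y ∈ FreeGroup.reduce (w.filter q) := by rw [hred]; simp
            exact (mem_filter.1 (mem_of_mem_reduce hy)).2
          refine ⟨x :: (pre ++ y :: g), rest, ?_, rfl, ?_, fun b hb => hgap b (by simp [hb])⟩
          · rw [hw]; simp
          · rw [filter_cons_of_pos hqx, filter_append, filter_cons_of_pos hqy, mk_cons_eq_sgen_mul,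
              mk_append, hpre, one_mul, ← mk_cons_eq_sgen_mul, mk_cons_cons_of_cancel hc]
            exact hgap (y, g) (by simp)
        · rw [if_neg hc]
          refine ⟨[], (x, pre) :: (y, g) :: rest, ?_, by simp, by simp [show (FreeGroup.mk [] : FreeGroup ι) = 1 from rfl], ?_⟩
          · rw [hw]; simp
          · rintro b hb
            simp only [mem_cons] at hb
            rcases hb with rfl | rfl | hb
            · exact hpre
            · exact hgap (y, g) (by simp)
            · exact hgap b (by simp [hb])
    · rw [filter_cons_of_neg hqx, hred]
      refine ⟨x :: pre, blocks, by rw [hw]; rfl, rfl, ?_, hgap⟩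
      rw [filter_cons_of_neg hqx]
      exact hpre

end Decomp

end Literature.GroupTheory.CombinatorialGroupTheory
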